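import Literature.NumberTheory.Transcendental.L2HodgeTheoryStarHarmonicProofs
import HarnessLib

/-!
# Poincaré duality for harmonic spaces: status of the named fact `finrank_harmonicForms_eq`

Companion of `Literature/NumberTheory/Transcendental/L2HodgeTheory.lean`, §*Hodge star and
harmonic forms: Poincaré duality (Warner 6.13)*, named fact
`Literature.NumberTheory.Transcendental.finrank_harmonicForms_eq` (`dim Hᵏ = dim H^{n-k}`), and of
`L2HodgeTheoryStarHarmonicProofs.lean`, which treats the sibling fact `hodgeStar_mem_harmonicForms`
and already provides the two ingredients used here: the linear isomorphism
`harmonicFormsHodgeStarEquiv : Hᵏ ≃ₗ[ℝ] Hᵐ` (`⋆`, for a smooth metric) and the bridge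
`finrank_harmonicForms_eq_of_contMDiffMetric` (the fact as declared, under the intended
instances). This file adds the **corrected closed statement** of `finrank_harmonicForms_eq` and
its discharge, completing the provefact protocol for that fact.

## What the source says

F. W. Warner, *Foundations of Differentiable Manifolds and Lie Groups*, GTM 94 (1983): 6.1 (1),
p. 220 — `** = (-1)^{p(n-p)}`; 6.1 (4), pp. 220–221 — "the Laplacian commutes with `*`, that
is, `*Δ = Δ*`"; proof of Thm. 6.13 (Poincaré duality for de Rham cohomology of a compact
oriented manifold), p. 226 — "Since `*Δ = Δ*`, it follows that `*φ` is also harmonic". Hence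
`*` restricts to a linear isomorphism `Hᵖ ≅ H^{n-p}` (inverse `± *`), so `dim Hᵖ = dim H^{n-p}`;
with the Hodge theorem 6.11 (`Hᵖ ≅ Hᵖ_{deR}(M)`, `M` closed) this is `b_p = b_{n-p}`. The
docstring of the fact cites "Cor. 6.13"; in Warner 6.13 is the *Theorem* (its Corollary is
`Hⁿ_{deR}(M) ≅ ℝ`), and the dimension statement is the harmonic-forms content of its proof.
Throughout Ch. 6 the metric is `C^∞` and `M` is a (Hausdorff, second countable) compact
oriented manifold (p. 220); compactness is not used by this step.

## Status of `finrank_harmonicForms_eq` (misstated: dropped instances)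

The fact is a `def … : Prop` written after `variable … [IsManifold I ∞ M] …` and inside
`section Closed` of `L2HodgeTheory.lean`, whose instance variables `[CompactSpace M]`,
`[I.Boundaryless]`, `[IsContinuousRiemannianBundle E (TangentSpace I)]`,
`[IsContMDiffRiemannianBundle I ∞ E (TangentSpace I)]` — like `[IsManifold I ∞ M]` — are *not
mentioned in its body*; a `def` abstracts only the section variables it uses, so none of them is
a hypothesis of the fact: `#check @finrank_harmonicForms_eq` binds `[ChartedSpace H M]
[FiniteDimensional ℝ E] [RiemannianBundle fun x ↦ TangentSpace I x] (o) {k m}` and nothing on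
the regularity of the metric (checked 2026-08-15). As declared it therefore asserts
`finrank ℝ Hᵏ = finrank ℝ Hᵐ` for *every* fibrewise family of inner products
(`Bundle.RiemannianBundle`, no regularity in the base point) on *every* charted space — the same
M5 defect as `isSmoothForm_hodgeStar`, `mem_harmonicForms_iff` (`RiemannianHodge.lean`, refuted
as declared in `RiemannianHodgeRoughMetric.lean`) and `hodgeStar_mem_harmonicForms` (refuted as
declared in `L2HodgeTheoryStarHarmonicProofs.lean`: for the rough unit-determinant metric
`a dx² + a⁻¹ dy²` on `ℝ²` the smooth form `dy` is junk-harmonic while `⋆dy = -a dx` is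
differentiable nowhere). In that generality Warner's argument is unavailable (`⋆` does not map
the span `Hᵏ` of *smooth* harmonic forms into `Hᵐ`), and no other argument is known: for rough
metrics `Hᵏ` is the span of the smooth solutions of an equation whose derivatives take junk
values. (Whether the bare `finrank` equality nevertheless survives for every rough metric is not
settled here: in the rough examples of the tree the junk derivatives make both `Hᵏ` and `Hᵐ`
infinite-dimensional, so both `finrank`s are `0`.) Following the provefact protocol — a
mis-stated fact is corrected under a new name and never edited in place (D-0014; the original
has no consumers) — this file states the fact with the hypotheses its proof uses,
`[IsManifold I ∞ M]` and `[IsContMDiffRiemannianBundle I ∞ E (TangentSpace I)]`, bound *inside*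
a closed statement (`finrank_harmonicForms_eq_of_isContMDiffRiemannianBundle`, exactly in the
format of `hodgeStar_mem_harmonicForms_of_isContMDiffRiemannianBundle` and
`isSmoothForm_hodgeStar_of_isContMDiffRiemannianBundle`) and discharges it (`…_holds`).
Compactness, `Boundaryless` and `IsContinuousRiemannianBundle` are not needed and not assumed, so
the printed (compact) case is an instance.

## Main statements (all proved)

* `finrank_harmonicForms_eq_harmonicForms`: for a smooth metric and an orientation family with
  smooth volume form, `finrank ℝ (harmonicForms o h) = finrank ℝ (harmonicForms o h')` for any
  degree witnesses `h : k + m = n`, `h' : m + k = n` (usable form; `LinearEquiv.finrank_eq` of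
  `harmonicFormsHodgeStarEquiv` — no finite-dimensionality is needed, finite-dimensionality of
  `Hᵏ` being Warner 6.8, not used).
* `finrank_harmonicForms_eq_of_isContMDiffRiemannianBundle` (named fact, corrected closed
  statement) and `finrank_harmonicForms_eq_of_isContMDiffRiemannianBundle_holds`.

## References

* F. W. Warner, *Foundations of Differentiable Manifolds and Lie Groups*, GTM 94, Springer
  (1983): 6.1 (1), (4), pp. 220–221; Thm. 6.13 and its proof, pp. 225–226.
* J. Jost, *Riemannian Geometry and Geometric Analysis*, §3.4.
-/

noncomputable section

open scoped Manifold ContDiff Topology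
open Bundle Module

namespace Literature.NumberTheory.Transcendental

open Literature.Geometry.Kaehler

/-! ### Usable form -/

section Smooth

variable {E : Type*} [NormedAddCommGroup E] [NormedSpace ℝ E] {n : ℕ} [Fact (finrank ℝ E = n)]
  {H : Type*} [TopologicalSpace H] {I : ModelWithCorners ℝ E H}
  {M : Type*} [TopologicalSpace M] [ChartedSpace H M] [IsManifold I ∞ M] [FiniteDimensional ℝ E]
  [RiemannianBundle (fun x : M ↦ TangentSpace I x)]
  [IsContMDiffRiemannianBundle I ∞ E (fun x : M ↦ TangentSpace I x)] {k m : ℕ}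
  (o : (x : M) → Orientation ℝ (TangentSpace I x) (Fin n))

/-- **Poincaré duality for harmonic spaces** (smooth metric, orientation family with smooth
volume form): `finrank ℝ Hᵏ = finrank ℝ Hᵐ` for `k + m = n` (any degree witnesses `h`, `h'`),
by the linear isomorphism `⋆ : Hᵏ ≃ₗ[ℝ] Hᵐ` (`harmonicFormsHodgeStarEquiv`: `⋆⋆ = ±1`,
Warner 6.1 (1), and `*Δ = Δ*`, 6.1 (4)) and `LinearEquiv.finrank_eq` (no finite-dimensionality
needed). With the Hodge theorem (Warner 6.11) this is `bₖ = b_{n-k}`. Warner (1983), Thm. 6.13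
(proof), pp. 225–226. [cite: WarnerGTM94, Thm. 6.13 (proof), p. 226] -/
theorem finrank_harmonicForms_eq_harmonicForms (ho : IsSmoothForm (riemannianVolumeForm o))
    (h : k + m = n) (h' : m + k = n) :
    finrank ℝ ↥(harmonicForms o h) = finrank ℝ ↥(harmonicForms o h') :=
  (harmonicFormsHodgeStarEquiv o ho h h').finrank_eq

end Smooth

/-! ### The corrected named fact -/

section CorrectedFact

/-- **Corrected statement of the named fact
`Literature.NumberTheory.Transcendental.finrank_harmonicForms_eq`** (`L2HodgeTheory.lean`):
Poincaré duality for harmonic spaces — on an oriented Riemannian `n`-manifold with *smooth*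
metric and an orientation family `o` with smooth volume form, `dim Hᵏ = dim H^{n-k}`
(`k + m = n`), because `*` restricts to a linear isomorphism `Hᵏ ≅ H^{n-k}` ("Since `*Δ = Δ*`,
it follows that `*φ` is also harmonic", Warner (1983), proof of Thm. 6.13, p. 226, with
`** = (-1)^{p(n-p)}`, 6.1 (1), p. 220).

Discrepancy with the original: `def finrank_harmonicForms_eq` sits after `variable …
[IsManifold I ∞ M]` and in a section with `[CompactSpace M] [I.Boundaryless]
[IsContinuousRiemannianBundle E (TangentSpace I)] [IsContMDiffRiemannianBundle I ∞ E
(TangentSpace I)]`, none of which its body uses, so (a `def` abstracts only the section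
variables it mentions) its signature binds only `[ChartedSpace H M] [FiniteDimensional ℝ E]
[RiemannianBundle _] (o) {k m}`: it speaks about every fibrewise family of inner products of no
regularity on every charted space, a generality in which `⋆` does not preserve smoothness and
does not map `Hᵏ` into `Hᵐ` (`roughMetric_not_hodgeStar_mem_harmonicForms`), so the printed
proof does not apply (see the module docstring). Here the hypotheses the proof uses,
`[IsManifold I ∞ M]` and `[IsContMDiffRiemannianBundle I ∞ E (TangentSpace I)]`, are bound
*inside* the closed statement, in the format of
`hodgeStar_mem_harmonicForms_of_isContMDiffRiemannianBundle`; Warner's standing "compact"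
(p. 220) is not used by this step and not assumed, so the printed case is an instance.
Discharged by `finrank_harmonicForms_eq_of_isContMDiffRiemannianBundle_holds`; usable forms:
`finrank_harmonicForms_eq_harmonicForms`, `harmonicFormsHodgeStarEquiv`, and, for the fact as
declared under the intended instances, `finrank_harmonicForms_eq_of_contMDiffMetric`.
[cite: WarnerGTM94, Thm. 6.13 (proof), p. 226] -/
def finrank_harmonicForms_eq_of_isContMDiffRiemannianBundle : Prop :=
  ∀ {E : Type*} [NormedAddCommGroup E] [NormedSpace ℝ E] {n : ℕ} [Fact (finrank ℝ E = n)]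
    {H : Type*} [TopologicalSpace H] {I : ModelWithCorners ℝ E H}
    {M : Type*} [TopologicalSpace M] [ChartedSpace H M] [IsManifold I ∞ M]
    [FiniteDimensional ℝ E] [RiemannianBundle (fun x : M ↦ TangentSpace I x)]
    [IsContMDiffRiemannianBundle I ∞ E (fun x : M ↦ TangentSpace I x)] {k m : ℕ}
    (o : (x : M) → Orientation ℝ (TangentSpace I x) (Fin n)),
    IsSmoothForm (riemannianVolumeForm o) → ∀ (h : k + m = n),
      finrank ℝ ↥(harmonicForms o h) = finrank ℝ ↥(harmonicForms o (show m + k = n by omega))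

/-- **Discharge** of `finrank_harmonicForms_eq_of_isContMDiffRiemannianBundle` (the corrected
form of the named fact `finrank_harmonicForms_eq`): immediate from
`finrank_harmonicForms_eq_harmonicForms` (the linear isomorphism `⋆ : Hᵏ ≃ Hᵐ`,
`harmonicFormsHodgeStarEquiv`). Warner (1983), Thm. 6.13 (proof), p. 226.
[cite: WarnerGTM94, Thm. 6.13 (proof), p. 226] -/
theorem finrank_harmonicForms_eq_of_isContMDiffRiemannianBundle_holds :
    finrank_harmonicForms_eq_of_isContMDiffRiemannianBundle :=
  fun o ho h ↦ finrank_harmonicForms_eq_harmonicForms o ho h (by omega)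

end CorrectedFact

end Literature.NumberTheory.Transcendental
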